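import Literature.NumberTheory.GaloisRepresentations.ContinuousShapiroOpenCoinducedMackeyVanishing
import Literature.NumberTheory.GaloisRepresentations.RelativeCorestrictionConj
import Literature.NumberTheory.GaloisRepresentations.ContinuousShapiroLiftFunctor
import HarnessLib

/-!
# The Shapiro isomorphism of the permutation model under CHANGE OF LAYER and of coefficients, all degrees:
# `sh_U ∘ Hⁿ(Σ_{V→U}) = cor_{V→U} ∘ sh_V`, `sh_V ∘ Hⁿ(π^*_{U→V}) = res_{U→V} ∘ sh_U`, `sh ∘ Hⁿ(Maps(f)) = Hⁿ(f|) ∘ sh`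
# (Serre, *Cohomologie galoisienne* I §2.5; NSW (1.5.3)–(1.6.5))

Generic continuous group cohomology (no number theory); namespace `Literature.NumberTheory.GaloisRepresentations`.
THEOREMS ONLY (no definition, no named fact, no `sorry`, no instance, no notation).  Sequel of
`ContinuousShapiroOpenCoinducedMackeyVanishing` (`ContinuousRep.shapiroCoindFinAddEquiv N hN n : Hⁿ(G, Maps(G ⧸ N, M)) ≃+
Hⁿ(N, M)`, which IS `Hⁿ(N ↪ G, ev₁)`, `shapiroCoindFinAddEquiv_apply`; the one-orbit identity
`shapiroCoindFinAddEquiv_cohomologyMap_resCoindFinHom_map`), of `Corestriction` / `CorestrictionTransitive` /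
`RelativeCorestrictionConj` (the all-degree corestriction `cor = Hⁿ(norm) ∘ sh⁻¹` of Serre's function model and the
relative corestriction `relCor U V ρ h n = cor_{V.subgroupOf U} ∘ toSubgroupOf : Hⁿ(V, M) → Hⁿ(U, M)`), and of
`ContinuousShapiroLiftPairing` / `ContinuousShapiroLiftFunctor` (the morphisms of permutation modules
`coindFinSum X h : Maps(G ⧸ V, X) ⟶ Maps(G ⧸ U, X)` (fibre sum along `G ⧸ V → G ⧸ U`), `coindFinRes X h : Maps(G ⧸ U, X) ⟶
Maps(G ⧸ V, X)` (pull-back) and `coindFinMap f N : Maps(G ⧸ N, X) ⟶ Maps(G ⧸ N, Y)`, whose degree-ONE Shapiro-lift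
compatibilities `cohomologyMap_coindFinSum_shapiroLift` / `…coindFinRes…` / `shapiroLift_cohomologyMap` are in the tree).

Setting: `G` profinite, `M` a discrete `G`-module (`ρ : ContinuousRep G ℤ M`, `X = ρ.toTopRep`), `V ≤ U ≤ G` OPEN subgroups,
`sh_N = ρ.shapiroCoindFinAddEquiv N hN n`.  This file proves, in EVERY degree `n`:

* §1 **`sh'_N (Hⁿ(Maps(G ⧸ N, f)) y) = Hⁿ(N, f|_N) (sh_N y)`** (`shapiroCoindFinAddEquiv_cohomologyMap_coindFinMap`) for a
  morphism `f : X ⟶ X'` of topological `G`-modules — Shapiro is natural in the coefficients;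
* §2 **`sh_V (Hⁿ(π^*) y) = res_{V ≤ U} (sh_U y)`** (`shapiroCoindFinAddEquiv_cohomologyMap_coindFinRes`; `res = resLe`) — under
  Shapiro the pull-back `φ ↦ φ ∘ π` along `π : G ⧸ V → G ⧸ U` is the RESTRICTION `Hⁿ(U, M) → Hⁿ(V, M)` (NSW (1.5.3)–(1.6.5));
* §3 **`cor_W (sh_W w) = Hⁿ(G, trace) w`** (`cor_shapiroCoindFinAddEquiv`: the tree's all-degree corestriction of the
  permutation-model Shapiro image is `Hⁿ` of the trace `φ ↦ Σ_y φ(y)`, `ContinuousRep.coindOpenTrace` — Serre's DEFINITION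
  `cor = Hⁿ(N_{G/W}) ∘ sh⁻¹` read in the permutation model), and its RELATIVE form
  **`sh_U (Hⁿ(Σ_{V→U}) y) = relCor U V ρ h n (sh_V y)`** (`shapiroCoindFinAddEquiv_cohomologyMap_coindFinSum`) — under Shapiro the
  fibre sum `(Σψ)(gU) = Σ_{g'V ⊆ gU} ψ(g'V)` is the relative CORESTRICTION `cor_{V→U} : Hⁿ(V, M) → Hⁿ(U, M)`.  Proof of the
  relative form: `ev₁^U ∘ Σ_{V→U} = trace_{U/V} ∘ Φ` on `Maps(G ⧸ V, X)|_U` with `Φ = resCoindFinHom` the Mackey projection onto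
  the trivial double coset (the fibre of `G ⧸ V → G ⧸ U` over `1·U` is the image of `U ⧸ V`), then the one-orbit identity and
  the absolute form for the profinite group `U`.

Consumer: the cor/res/coefficient LAYER-CHANGE DICTIONARY of the Ш-condition transport
`GaloisCohomology/ShaRestrictedShapiroLayerChange` (cell `bsd-print-cf2`, ROW 1 of the JLK descent: the Poitou–Tate pairing on
the layers `K̃_n` of a `ℤ_p²`-tower moves by `cor` in the first variable, `res` in the second and by `ζ ↦ ζ^p` in the
coefficients).  HONEST FRAMING: bookkeeping of continuous cohomology; no arithmetic is proved here.

## References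
* J.-P. Serre, *Galois Cohomology* (1997), I §2.5 (induced modules; Prop. 10; the corestriction `cor = H(π) ∘ sh⁻¹`).
  [SerreGaloisCohomology1997]
* J. Neukirch, A. Schmidt, K. Wingberg, *Cohomology of Number Fields*, 2nd ed. (2008), I §5 Prop. (1.5.3)–(1.5.4) (res, cor
  as maps of induced modules), I §6 Prop. (1.6.4)–(1.6.5) (Shapiro and its functoriality). [NeukirchSchmidtWingberg2008]
* J.-P. Serre, *Local Fields* (1979), VII §5–§6 (induced modules, `res`/`cor` through `A ⊗ ℤ[G/H]`). [SerreLocalFields1979]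
* K. S. Brown, *Cohomology of Groups* (1982), III §5 (5.6)(b), III §9 (res/cor via (co)induction). [Brown1982]
-/

noncomputable section

open CategoryTheory

open scoped Classical

universe u

namespace Literature.NumberTheory.GaloisRepresentations

open _root_.TopRep
open Literature.NumberTheory.EllipticCurves (subgroupInclusion)

variable {G : Type u} [Group G] [TopologicalSpace G] [IsTopologicalGroup G] [CompactSpace G]
  [T2Space G] [TotallyDisconnectedSpace G]
variable {M : Type u} [AddCommGroup M] [TopologicalSpace M] [DiscreteTopology M]
variable {M' : Type u} [AddCommGroup M'] [TopologicalSpace M'] [DiscreteTopology M']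
variable (ρ : ContinuousRep G ℤ M) (ρ' : ContinuousRep G ℤ M')

/-! ## §1 Coefficients: `sh ∘ Hⁿ(Maps(G ⧸ N, f)) = Hⁿ(N, f|_N) ∘ sh` -/

section Coeff

variable (N : Subgroup G) (hN : IsOpen (N : Set G))

/-- **Shapiro is natural in the coefficients, every degree**: for a morphism `f : X ⟶ X'` of topological `G`-modules,
`sh'_N (Hⁿ(G, Maps(G ⧸ N, f)) y) = Hⁿ(N, f|_N) (sh_N y)` — both sides are `Hⁿ` of the compatible pair
`(N ↪ G, φ ↦ f(φ(1·N)))`.  (Degree-one Shapiro-lift form: the tree's `shapiroLift_cohomologyMap`.)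
[cite: NeukirchSchmidtWingberg2008, I §6 Prop. (1.6.4)–(1.6.5)] [cite: SerreLocalFields1979, VII §6] -/
theorem ContinuousRep.shapiroCoindFinAddEquiv_cohomologyMap_coindFinMap (f : ρ.toTopRep ⟶ ρ'.toTopRep) (n : ℕ)
    (y : continuousCohomology n (coindFin.{0, u} ρ.toTopRep N)) :
    ρ'.shapiroCoindFinAddEquiv N hN n (cohomologyMap (coindFinMap f N) n y) =
      cohomologyMap (subgroupRepMap f N) n (ρ.shapiroCoindFinAddEquiv N hN n y) := by
  rw [ContinuousRep.shapiroCoindFinAddEquiv_apply, ContinuousRep.shapiroCoindFinAddEquiv_apply,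
    map_cohomologyMap_eq_map]
  exact map_comp_apply_of (subgroupIncl N) (ContinuousMonoidHom.id N) (subgroupIncl N) (fun _ => rfl)
    (coindFinEvalAtOne ρ.toTopRep N) (resIdHom (subgroupRepMap f N))
    ((TopRep.resFunctor (subgroupIncl N : N →* G)).map (coindFinMap f N) ≫ coindFinEvalAtOne ρ'.toTopRep N)
    (fun _ => rfl) n y

end Coeff

/-! ## §2 Change of layer, pull-back: `sh_V ∘ Hⁿ(π^*_{U→V}) = res_{V ≤ U} ∘ sh_U` -/

section Res

variable {U V : Subgroup G} (hVU : V ≤ U) (hU : IsOpen (U : Set G)) (hV : IsOpen (V : Set G))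

/-- **Under Shapiro the pull-back `φ ↦ φ ∘ π` (`π : G ⧸ V → G ⧸ U`) is the restriction `Hⁿ(U, M) → Hⁿ(V, M)`, every
degree**: `sh_V (Hⁿ(G, coindFinRes) y) = resLe_{V ≤ U} (sh_U y)` — both sides are `Hⁿ` of the pair `(V ↪ G, φ ↦ φ(1·U))`
(`(φ ∘ π)(1·V) = φ(1·U)`).  (Degree-one Shapiro-lift form: the tree's `cohomologyMap_coindFinRes_shapiroLift`.)
[cite: NeukirchSchmidtWingberg2008, I §5 Prop. (1.5.3) and I §6 Prop. (1.6.4)–(1.6.5)] [cite: SerreLocalFields1979, VII §5–§6] -/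
theorem ContinuousRep.shapiroCoindFinAddEquiv_cohomologyMap_coindFinRes (n : ℕ)
    (y : continuousCohomology n (coindFin.{0, u} ρ.toTopRep U)) :
    ρ.shapiroCoindFinAddEquiv V hV n (cohomologyMap (coindFinRes ρ.toTopRep hVU) n y) =
      resLe ρ.toTopRep hVU n (ρ.shapiroCoindFinAddEquiv U hU n y) := by
  rw [ContinuousRep.shapiroCoindFinAddEquiv_apply, ContinuousRep.shapiroCoindFinAddEquiv_apply,
    map_cohomologyMap_eq_map]
  exact map_comp_apply_of (subgroupIncl U) (subgroupInclusion hVU) (subgroupIncl V) (fun _ => rfl)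
    (coindFinEvalAtOne ρ.toTopRep U)
    (TopRep.ofHom ⟨ContinuousLinearMap.id ℤ _, fun _ => rfl⟩ :
      TopRep.res (subgroupInclusion hVU : V →* U) (subgroupRep ρ.toTopRep U) ⟶ subgroupRep ρ.toTopRep V)
    ((TopRep.resFunctor (subgroupIncl V : V →* G)).map (coindFinRes ρ.toTopRep hVU) ≫ coindFinEvalAtOne ρ.toTopRep V)
    (fun _ => rfl) n y

end Res

/-! ## §3 Change of layer, fibre sum: `cor ∘ sh = Hⁿ(trace)` and `sh_U ∘ Hⁿ(Σ_{V→U}) = relCor_{V→U} ∘ sh_V` -/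

section Fibre

variable {U V : Subgroup G} (hVU : V ≤ U) [Fintype (G ⧸ V)] [Fintype (U ⧸ V.subgroupOf U)]

omit [IsTopologicalGroup G] [CompactSpace G] [T2Space G] [TotallyDisconnectedSpace G] in
/-- The fibre of `G ⧸ V → G ⧸ U` over the unit coset is the image of `U ⧸ (V ∩ U)`: evaluating the fibre sum `Σ_{V→U} ψ`
at `1·U` gives the trace over `U ⧸ (V ∩ U)` of the Mackey coordinate `Φ ψ = ψ|_{U/V}` (`resCoindFinHom` along `U ↪ G`).
[cite: NeukirchSchmidtWingberg2008, I §5 (coset decompositions in the proof of Prop. (1.5.3))] -/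
theorem coindFinSum_apply_one_eq_sum (X : TopRep.{u} ℤ G) (ψ : coindFin X V) :
    (coindFinSum X hVU).hom ψ ((1 : G) : G ⧸ U) =
      ∑ w : U ⧸ V.subgroupOf U, (resCoindFinHom X V (subgroupIncl U)).hom ψ w := by
  rw [coindFinSum_apply]
  -- `e : U ⧸ (V ∩ U) ↪ G ⧸ V`, `uV ↦ uV`, whose image is the fibre over `1·U`
  let e : (U ⧸ V.subgroupOf U) ↪ G ⧸ V :=
    ⟨fun w => quotientMapOfHom V (subgroupIncl U) w, fun a b h => quotientMapOfHom_injective V (subgroupIncl U) h⟩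
  have himg : (Finset.univ : Finset (U ⧸ V.subgroupOf U)).map e =
      Finset.univ.filter (fun z : G ⧸ V => Subgroup.quotientMapOfLE hVU z = ((1 : G) : G ⧸ U)) := by
    ext z
    simp only [Finset.mem_map, Finset.mem_univ, true_and, Finset.mem_filter]
    constructor
    · rintro ⟨w, rfl⟩
      induction w using QuotientGroup.induction_on with
      | H u =>
        change Subgroup.quotientMapOfLE hVU (((u : U) : G) : G ⧸ V) = ((1 : G) : G ⧸ U)
        rw [Subgroup.quotientMapOfLE_apply_mk]
        exact QuotientGroup.eq.2 (by rw [mul_one]; exact U.inv_mem u.2)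
    · intro hz
      induction z using QuotientGroup.induction_on with
      | H g =>
        rw [Subgroup.quotientMapOfLE_apply_mk] at hz
        have hg : g ∈ U := by
          have h' := QuotientGroup.eq.1 hz
          rw [mul_one] at h'
          exact (U.inv_mem_iff).1 h'
        exact ⟨((⟨g, hg⟩ : U) : U ⧸ V.subgroupOf U), rfl⟩
  calc (∑ z : G ⧸ V, if Subgroup.quotientMapOfLE hVU z = ((1 : G) : G ⧸ U) then ψ z else 0)
      = ∑ z ∈ Finset.univ.filter (fun z : G ⧸ V => Subgroup.quotientMapOfLE hVU z = ((1 : G) : G ⧸ U)), ψ z :=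
        (Finset.sum_filter _ _).symm
    _ = ∑ z ∈ (Finset.univ : Finset (U ⧸ V.subgroupOf U)).map e, ψ z := by rw [himg]
    _ = ∑ w : U ⧸ V.subgroupOf U, ψ (e w) := Finset.sum_map _ e _
    _ = ∑ w : U ⧸ V.subgroupOf U, (resCoindFinHom X V (subgroupIncl U)).hom ψ w :=
        Finset.sum_congr rfl fun w _ => (resCoindFinHom_apply X V (subgroupIncl U) ψ w).symm

end Fibre

section Cor

/-- **`cor_W (sh_W w) = Hⁿ(G, trace) w`, every degree** (Serre's model `ρ.coindOpen W hW`): the tree's all-degree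
corestriction `cor W ρ n` (`Corestriction.lean`: Serre's `Hⁿ(N_{G/W}) ∘ ext`, `ext = sh⁻¹` on the function model
`M_G^W(M)`) of the permutation-model Shapiro image of `w ∈ Hⁿ(G, Maps(G ⧸ W, M))` is `Hⁿ(G, r) w` for the trace
`r φ = Σ_{y ∈ G/W} φ(y)` (`ContinuousRep.coindOpenTrace`): the comparison `Maps(G ⧸ W, M) ≅ M_G^W(M)`, `φ ↦ (x ↦ x • φ(x⁻¹ W))`,
carries `r` to Serre's norm `a* ↦ Σ_c c̃ • a*(c̃⁻¹)`.  This is Serre's DEFINITION of the corestriction, read in the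
permutation model. [cite: SerreGaloisCohomology1997, I §2.5 (corestriction)] [cite: NeukirchSchmidtWingberg2008, I §5 Prop. (1.5.3)] -/
theorem ContinuousRep.cor_shapiroOpenAddEquiv (W : Subgroup G) (hW : IsOpen (W : Set G)) [IsClosed (W : Set G)]
    [Fintype (G ⧸ W)] (n : ℕ) (w : continuousCohomology n (ρ.coindOpen W hW).toTopRep) :
    cor W ρ n (ρ.shapiroOpenAddEquiv W hW n w) = cohomologyMap (ρ.coindOpenTrace W hW) n w := by
  -- Serre's model: `cor (sh w') = Hⁿ(norm) (ext (sh w')) = Hⁿ(norm) w'`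
  have key : ∀ w' : continuousCohomology n (coindRep (ρ.restrict (subgroupIncl W))).toTopRep,
      cor W ρ n (shapiroAddEquiv (ρ.restrict (subgroupIncl W)) n w') = cohomologyMap (normCoind ρ) n w' := by
    intro w'
    rw [shapiroAddEquiv_apply]
    exact (cor_apply W ρ n _).trans (congrArg (cohomologyMap (normCoind ρ) n) (extMap_shMap_all W ρ n w'))
  unfold ContinuousRep.shapiroOpenAddEquiv
  rw [AddEquiv.trans_apply, key]
  -- transport `Hⁿ(norm)` back along `Maps(G ⧸ W, M) ≅ M_G^W(M)`: the norm becomes the trace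
  have hnat := continuousCohomologyAddEquiv_map
    (X := (ρ.coindOpen W hW).toTopRep) (X' := (coindRep (ρ.restrict (subgroupIncl W))).toTopRep)
    (Y := ρ.toTopRep) (Y' := ρ.toTopRep)
    (ρ.coindOpenEquiv W hW : (G ⧸ W → M) ≃ₜ+ _) (fun g φ => ρ.coindOpenEquiv_map W hW g φ)
    (ContinuousAddEquiv.refl M) (fun _ _ => rfl)
    (ContinuousMonoidHom.id G) (resIdHom (ρ.coindOpenTrace W hW)) (resIdHom (normCoind ρ))
    (fun φ => by
      change ∑ y : G ⧸ W, φ y = ∑ c : G ⧸ W, normTerm ρ (ρ.toCoindModule W hW φ) c.out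
      refine Finset.sum_congr rfl fun c _ => ?_
      rw [normTerm, ContinuousRep.toCoindModule_apply, inv_inv, ← Module.End.mul_apply, ← map_mul,
        mul_inv_cancel, map_one, Module.End.one_apply, QuotientGroup.out_eq']) n w
  have hrefl := continuousCohomologyAddEquiv_refl' (X := ρ.toTopRep) n
    ((ContinuousCohomology.map (ContinuousMonoidHom.id G) (resIdHom (ρ.coindOpenTrace W hW)) n).hom w)
  exact (hrefl.symm.trans hnat).symm

/-- **`cor_W (sh_W w) = Hⁿ(G, trace) w`, every degree**, read on the tree's `coindFin ρ.toTopRep W` /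
`shapiroCoindFinAddEquiv` (the SAME statement as `cor_shapiroOpenAddEquiv`, definitionally).
[cite: SerreGaloisCohomology1997, I §2.5 (corestriction)] [cite: NeukirchSchmidtWingberg2008, I §5 Prop. (1.5.3)] -/
theorem ContinuousRep.cor_shapiroCoindFinAddEquiv (W : Subgroup G) (hW : IsOpen (W : Set G)) [IsClosed (W : Set G)]
    [Fintype (G ⧸ W)] (n : ℕ) (w : continuousCohomology n (coindFin.{0, u} ρ.toTopRep W)) :
    cor W ρ n (ρ.shapiroCoindFinAddEquiv W hW n w) =
      cohomologyMap (ρ.coindOpenTrace W hW : coindFin.{0, u} ρ.toTopRep W ⟶ ρ.toTopRep) n w :=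
  ρ.cor_shapiroOpenAddEquiv W hW n w

variable {U V : Subgroup G} (hVU : V ≤ U) (hU : IsOpen (U : Set G)) (hV : IsOpen (V : Set G))
  [IsClosed (U : Set G)] [IsClosed (V : Set G)] [Fintype (G ⧸ V)] [Fintype (U ⧸ V.subgroupOf U)]

/-- **Under Shapiro the fibre sum `Σ_{V→U}` is the relative corestriction `cor_{V→U} : Hⁿ(V, M) → Hⁿ(U, M)`, every
degree**: `sh_U (Hⁿ(G, coindFinSum) y) = relCor U V ρ h n (sh_V y)` for open `V ≤ U ≤ G` (the tree's
`relCor = cor_{V.subgroupOf U} ∘ toSubgroupOf`, `RelativeCorestrictionConj.lean`; the `Fintype` instances are arbitrary).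
Proof: `sh_U ∘ Hⁿ(Σ) = Hⁿ(U ↪ G, ev₁^U ∘ Σ)`, `ev₁^U ∘ Σ = trace_{U/V} ∘ Φ` (`coindFinSum_apply_one_eq_sum`), the one-orbit
identity `sh^U_{U∩V}(Hⁿ(Φ)(res y)) = toSubgroupOf (sh_V y)` and `cor ∘ sh = Hⁿ(trace)` for the profinite group `U`
(`cor_shapiroCoindFinAddEquiv`).  (Degree-one Shapiro-lift form: the tree's `cohomologyMap_coindFinSum_shapiroLift`; NSW
(1.5.3): `cor` is induced by the norm of induced modules.)
[cite: SerreGaloisCohomology1997, I §2.5 (corestriction)] [cite: NeukirchSchmidtWingberg2008, I §5 Prop. (1.5.3)–(1.5.4), I §6 Prop. (1.6.4)–(1.6.5)] -/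
theorem ContinuousRep.shapiroCoindFinAddEquiv_cohomologyMap_coindFinSum (n : ℕ)
    (y : continuousCohomology n (coindFin.{0, u} ρ.toTopRep V)) :
    ρ.shapiroCoindFinAddEquiv U hU n (cohomologyMap (coindFinSum ρ.toTopRep hVU) n y) =
      relCor U V ρ hVU n (ρ.shapiroCoindFinAddEquiv V hV n y) := by
  have hW : IsOpen ((V.subgroupOf U : Subgroup U) : Set U) := isOpen_subgroupOf U hV
  haveI : IsClosed ((V.subgroupOf U : Subgroup U) : Set U) := Subgroup.isClosed_of_isOpen _ hW
  haveI : CompactSpace U := isCompact_iff_compactSpace.mp (Subgroup.isClosed_of_isOpen U hU).isCompact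
  -- (1) `sh_U (Hⁿ(Σ) y) = Hⁿ(U ↪ G, ev₁ ∘ Σ) y = Hⁿ(U, trace) (Hⁿ(U ↪ G, Φ) y)`
  have h12 : ρ.shapiroCoindFinAddEquiv U hU n (cohomologyMap (coindFinSum ρ.toTopRep hVU) n y) =
      cohomologyMap ((ρ.restrict (subgroupIncl U)).coindOpenTrace (V.subgroupOf U) hW :
          coindFin.{0, u} (ρ.restrict (subgroupIncl U)).toTopRep (V.subgroupOf U) ⟶
            (ρ.restrict (subgroupIncl U)).toTopRep) n
        ((ContinuousCohomology.map (subgroupIncl U) (resCoindFinHom ρ.toTopRep V (subgroupIncl U)) n).hom y) := by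
    rw [ContinuousRep.shapiroCoindFinAddEquiv_apply, map_cohomologyMap_eq_map]
    exact map_comp_apply_of (subgroupIncl U) (ContinuousMonoidHom.id U) (subgroupIncl U) (fun _ => rfl)
      (resCoindFinHom ρ.toTopRep V (subgroupIncl U))
      (resIdHom ((ρ.restrict (subgroupIncl U)).coindOpenTrace (V.subgroupOf U) hW :
          coindFin.{0, u} (ρ.restrict (subgroupIncl U)).toTopRep (V.subgroupOf U) ⟶
            (ρ.restrict (subgroupIncl U)).toTopRep))
      ((TopRep.resFunctor (subgroupIncl U : U →* G)).map (coindFinSum ρ.toTopRep hVU) ≫ coindFinEvalAtOne ρ.toTopRep U)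
      (fun ψ => coindFinSum_apply_one_eq_sum hVU ρ.toTopRep ψ) n y
  -- (2) `Hⁿ(U, trace) = cor ∘ sh` on `U` (absolute form) and the one-orbit identity for `Hⁿ(U ↪ G, Φ) y`
  have h3 : cohomologyMap ((ρ.restrict (subgroupIncl U)).coindOpenTrace (V.subgroupOf U) hW :
          coindFin.{0, u} (ρ.restrict (subgroupIncl U)).toTopRep (V.subgroupOf U) ⟶
            (ρ.restrict (subgroupIncl U)).toTopRep) n
        ((ContinuousCohomology.map (subgroupIncl U) (resCoindFinHom ρ.toTopRep V (subgroupIncl U)) n).hom y) =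
      cor (V.subgroupOf U) (ρ.restrict (subgroupIncl U)) n
        ((ContinuousCohomology.map (comapSubtypeHom V (subgroupIncl U))
          (comapCoeffHom ρ.toTopRep V (subgroupIncl U)) n).hom (ρ.shapiroCoindFinAddEquiv V hV n y)) := by
    rw [← shapiroCoindFinAddEquiv_cohomologyMap_resCoindFinHom_map ρ V hV (subgroupIncl U) n y,
      cohomologyMap_map_id_eq_map]
    exact (ContinuousRep.cor_shapiroCoindFinAddEquiv (ρ.restrict (subgroupIncl U)) (V.subgroupOf U) hW n _).symm
  -- (3) the restriction along `U ∩ V → V` of the one-orbit identity IS `toSubgroupOf`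
  have h4 : (ContinuousCohomology.map (comapSubtypeHom V (subgroupIncl U))
        (comapCoeffHom ρ.toTopRep V (subgroupIncl U)) n).hom (ρ.shapiroCoindFinAddEquiv V hV n y) =
      (toSubgroupOf ρ.toTopRep hVU n).hom (ρ.shapiroCoindFinAddEquiv V hV n y) :=
    congrArg (fun T => TopModuleCat.Hom.hom T (ρ.shapiroCoindFinAddEquiv V hV n y))
      (continuousCohomology_map_congr
        (show comapSubtypeHom V (subgroupIncl U) = subgroupOfHom hVU from ContinuousMonoidHom.ext fun _ => rfl)
        (comapCoeffHom ρ.toTopRep V (subgroupIncl U))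
        (TopRep.ofHom ⟨ContinuousLinearMap.id ℤ _, fun _ => rfl⟩) (fun _ => rfl) n)
  rw [h12, h3, h4]
  exact (relCor_apply U V ρ hVU n _).symm

end Cor

end Literature.NumberTheory.GaloisRepresentations

end
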